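import Summits.HodgeConjecture.CorCM.Model.Universe
import Summits.HodgeConjecture.CorCM.Model.CMProdBiproduct
import Literature.AlgebraicGeometry.HodgeTheory.WeilClassesCMReductionProductForm
import Literature.AlgebraicGeometry.HodgeTheory.WeilClassesIsogenyDescent
import HarnessLib

/-!
# COR-CM (cell `pub-hodgecm2`): the four corner realisations of a face as a left-nested product AND as a
# biproduct — bookkeeping for the Weil-line junction `Model/WeilFaceAlgebraicOfWeilLineClasses.lean`

HONEST FRAMING. Definitions-and-bookkeeping file (no new mathematics, no case of the Hodge conjecture). The
stage-1 universe (`CorCM/Geometry/Universe.lean`) forms the corner product of four CM types as the LEFT-NESTED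
binary product `P = ((A_{Φ₀} × A_{Φ₁}) × A_{Φ₂}) × A_{Φ₃}` (`Universe.prod4`, projections `Universe.pr4`), while
André's product form on the tree's real carriers (`HodgeTheory/WeilClassesCMReductionProductForm.lean`:
`diagonalAction`, `weilLineClasses`; consumer `AndreProductForm.mem_algebraicClasses_cmTypedProduct`) lives on the
BIPRODUCT `⨁_j A_j` of the preadditive category `AbelianVariety ℂ`.  This file provides, for any
`A : Fin 4 → AbelianVariety ℂ`:

* `FourCorner.prodAV`, `FourCorner.pr`, `FourCorner.lift`, `FourCorner.hom_ext` — the left-nested product as an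
  abelian variety (underlying scheme = the model's `prod4` ON THE NOSE), its projections and universal property
  (the tree's `AbelianVariety.prod` / `prodLift` / `prod_hom_ext`, Mumford §19);
* `FourCorner.toBiprod`, `FourCorner.ofBiprod`, `toBiprod ≫ ofBiprod = 𝟙` — the comparison with `⨁ A`;
* `FourCorner.act4` with `diagonalAction ≫ ofBiprod = ofBiprod ≫ act4` — the product action of `𝓞_K`;
* `FourCorner.gen`, `map_act4_gen`, **`map_ofBiprod_gen_mem_weilLineClasses`** — the same-character cup monomial
  `pr₀^*y₀ ∪ pr₁^*y₁ ∪ pr₂^*y₂ ∪ pr₃^*y₃` and the cohomological heart of the junction: pulled back to `⨁ A` it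
  is a simultaneous `σ(a)⁴`-eigenclass of the diagonal action, i.e. a `K`-Weil-line class (Milne 2020 §2: «`a ∈ E`
  acts on `H^{2p}(A_Δ)_{Δ×{t}}` as multiplication by `∏_{s∈Δ}(t∘s)(a)`»; naturality of `∪` and of pull-backs);

and, for the model universe of record `Model.universeOf hHD hI hU h₃` (`CorCM/Model/Universe.lean`), a CM field `F`
and four CM types `Φ`:

* `cornerAV`, `cornerAct`, `cornerTheta` — the corner realisations
  `A_{(F,Φ_j)} = (cmRealisation h₃ (Model.cmCode F (Φ j))).AV` READ OVER `F` (actions pulled back along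
  `Model.cmCodeEquiv F (Φ j)`, the spelling of `Domination.isCMTypeRealisation_cmCode`), with
  `cornerAV_isCMTypeRealisation`, the `rfl` identifications `prodAV_X` / `pr_hom` with the model's `prod4` / `pr4`,
  and `map_cornerAct` (`(act_j a)^* = θ_j(a)` on `H¹`).

References: D. Mumford, *Abelian Varieties* (1970) §19; J. S. Milne, *Hodge classes on abelian varieties* (2020,
arXiv:2010.08857) §2; P. Deligne, LNM 900 (1982), endnote M.12; Y. André, Progr. Math. 102 (1992) pp. 4–5.
-/

noncomputable section

open scoped TensorProduct
open CategoryTheory CategoryTheory.Limits NumberField MonoidalCategory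
open Literature.AlgebraicTopology.SingularHomology
open Literature.AlgebraicGeometry.Motives Literature.AlgebraicGeometry.HodgeTheory
open Literature.AlgebraicGeometry.ComplexMultiplication
open Literature.NumberTheory.Automorphic
open Literature.NumberTheory.Automorphic.PicardCM (CMCode cmRealisation BallQuotientUniformisedDatum
  CMAbelianVarietyRealised)

namespace Summit.HodgeConjecture.CorCM.Model

/-! ## §1 Four-fold left-nested products of abelian varieties, their biproduct, and same-character monomials -/

namespace FourCorner

variable (A : Fin 4 → AbelianVariety ℂ)

/-- The left-nested product `((A₀ × A₁) × A₂) × A₃` as an abelian variety (its underlying scheme is the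
model's `Universe.prod4` on the nose). [folklore] -/
abbrev prodAV : AbelianVariety ℂ := (((A 0).prod (A 1)).prod (A 2)).prod (A 3)

/-- The four projections `((A₀ × A₁) × A₂) × A₃ → A_j` (homomorphisms; their underlying `ℂ`-morphisms are the
model's `Universe.pr4`). [folklore] -/
def pr : (j : Fin 4) → (prodAV A ⟶ A j)
  | 0 => AbelianVariety.fst _ _ ≫ (AbelianVariety.fst _ _ ≫ AbelianVariety.fst _ _)
  | 1 => AbelianVariety.fst _ _ ≫ (AbelianVariety.fst _ _ ≫ AbelianVariety.snd _ _)
  | 2 => AbelianVariety.fst _ _ ≫ AbelianVariety.snd _ _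
  | 3 => AbelianVariety.snd _ _

variable {A} in
/-- The pairing `(g₀, g₁, g₂, g₃) : T → ((A₀ × A₁) × A₂) × A₃` of four homomorphisms. [folklore] -/
def lift {T : AbelianVariety ℂ} (g : (j : Fin 4) → (T ⟶ A j)) : T ⟶ prodAV A :=
  AbelianVariety.prodLift (AbelianVariety.prodLift (AbelianVariety.prodLift (g 0) (g 1)) (g 2)) (g 3)

variable {A} in
/-- `(g₀, …, g₃) ≫ pr_j = g_j`. [folklore] -/
@[simp]
theorem lift_pr {T : AbelianVariety ℂ} (g : (j : Fin 4) → (T ⟶ A j)) (j : Fin 4) :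
    lift g ≫ pr A j = g j := by
  fin_cases j <;> simp [lift, pr]

variable {A} in
/-- Two homomorphisms into the four-fold product agree if their four components do. [folklore] -/
theorem hom_ext {T : AbelianVariety ℂ} {f f' : T ⟶ prodAV A} (h : ∀ j, f ≫ pr A j = f' ≫ pr A j) :
    f = f' := by
  refine AbelianVariety.prod_hom_ext (AbelianVariety.prod_hom_ext (AbelianVariety.prod_hom_ext ?_ ?_) ?_) ?_
  · simpa [pr, Category.assoc] using h 0
  · simpa [pr, Category.assoc] using h 1
  · simpa [pr, Category.assoc] using h 2
  · simpa [pr] using h 3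

/-- The comparison `((A₀ × A₁) × A₂) × A₃ → ⨁_j A_j` (components the projections). [folklore] -/
def toBiprod : prodAV A ⟶ ⨁ A := biproduct.lift (pr A)

/-- The comparison `⨁_j A_j → ((A₀ × A₁) × A₂) × A₃` (components the biproduct projections). [folklore] -/
def ofBiprod : (⨁ A) ⟶ prodAV A := lift (biproduct.π A)

/-- `toBiprod ≫ π_j = pr_j`. [folklore] -/
@[simp]
theorem toBiprod_π (j : Fin 4) : toBiprod A ≫ biproduct.π A j = pr A j :=
  biproduct.lift_π _ _

/-- `ofBiprod ≫ pr_j = π_j`. [folklore] -/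
@[simp]
theorem ofBiprod_pr (j : Fin 4) : ofBiprod A ≫ pr A j = biproduct.π A j :=
  lift_pr _ _

/-- `toBiprod ≫ ofBiprod = 𝟙` (both sides have components `pr_j`). [folklore] -/
@[simp]
theorem toBiprod_ofBiprod : toBiprod A ≫ ofBiprod A = 𝟙 (prodAV A) :=
  hom_ext fun j => by rw [Category.assoc, ofBiprod_pr, toBiprod_π, Category.id_comp]

variable {K : Type} [Field K]

/-- The product action of `a ∈ 𝓞_K` on `((A₀ × A₁) × A₂) × A₃` through actions `act j` on the factors
(components `pr_j ≫ act_j a`). [folklore] -/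
def act4 (act : ∀ j, 𝓞 K →+* End (A j)) (a : 𝓞 K) : prodAV A ⟶ prodAV A :=
  lift fun j => pr A j ≫ act j a

/-- `act4 a ≫ pr_j = pr_j ≫ act_j a`. [folklore] -/
@[simp]
theorem act4_pr (act : ∀ j, 𝓞 K →+* End (A j)) (a : 𝓞 K) (j : Fin 4) :
    act4 A act a ≫ pr A j = pr A j ≫ act j a :=
  lift_pr _ _

/-- The diagonal action on `⨁ A` and the product action on `((A₀ × A₁) × A₂) × A₃` are intertwined by
`ofBiprod`. [cite: Deligne1982HodgeCycles, endnote M.12 (p. 64)] -/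
theorem diagonalAction_ofBiprod (act : ∀ j, 𝓞 K →+* End (A j)) (a : 𝓞 K) :
    diagonalAction A act a ≫ ofBiprod A = ofBiprod A ≫ act4 A act a :=
  hom_ext fun j => by
    rw [Category.assoc, ofBiprod_pr, Category.assoc, act4_pr, ← Category.assoc, ofBiprod_pr,
      diagonalAction_def, biproduct.map_π]

/-! ### Cohomology: same-character cup monomials -/

/-- The cup monomial `pr₀^*y₀ ∪ pr₁^*y₁ ∪ pr₂^*y₂ ∪ pr₃^*y₃ ∈ H⁴(P(ℂ); ℂ)` of four degree-one classes, bracketed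
`(· ∪ ·) ∪ (· ∪ ·)` as in the model's `Universe.quadC`. [folklore] -/
def gen (y : ∀ j, complexBetti (A j).X 1) : complexBetti (prodAV A).X 4 :=
  cupProduct (show 2 + 2 = 4 by rfl)
    (cupProduct (show 1 + 1 = 2 by rfl) (complexBetti.map (pr A 0).hom.hom.hom 1 (y 0))
      (complexBetti.map (pr A 1).hom.hom.hom 1 (y 1)))
    (cupProduct (show 1 + 1 = 2 by rfl) (complexBetti.map (pr A 2).hom.hom.hom 1 (y 2))
      (complexBetti.map (pr A 3).hom.hom.hom 1 (y 3)))

/-- Bilinearity of the cup product: `(c • x) ∪ (d • y) = (c d) • (x ∪ y)`. [folklore] -/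
theorem cupProduct_smul_smul {Y : Type} [TopologicalSpace Y] {p q n : ℕ} (h : p + q = n) (c d : ℂ)
    (x : singularCohomology ℂ ℂ Y p) (y : singularCohomology ℂ ℂ Y q) :
    cupProduct h (c • x) (d • y) = (c * d) • cupProduct h x y := by
  rw [LinearMap.map_smul₂, map_smul, smul_smul]

/-- If each `y_j` is a `c`-eigenvector of `(act_j a)^*`, the cup monomial is a `c⁴`-eigenvector of `(act4 a)^*`
(pull-backs are multiplicative, `act4 a ≫ pr_j = pr_j ≫ act_j a`). [cite: Milne2020HodgeClassesAV, §2.1–2.2] -/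
theorem map_act4_gen (act : ∀ j, 𝓞 K →+* End (A j)) (a : 𝓞 K) (y : ∀ j, complexBetti (A j).X 1) (c : ℂ)
    (hy : ∀ j, complexBetti.map (act j a).hom.hom.hom 1 (y j) = c • y j) :
    complexBetti.map (act4 A act a).hom.hom.hom 4 (gen A y) = c ^ 4 • gen A y := by
  -- the four pulled-back classes `b j := pr_j^* y_j` are `c`-eigenvectors of `(act4 a)^*`
  have hfac : ∀ j, complexBetti.map (act4 A act a).hom.hom.hom 1
      (complexBetti.map (pr A j).hom.hom.hom 1 (y j)) = c • complexBetti.map (pr A j).hom.hom.hom 1 (y j) :=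
    fun j => by
      rw [abelianVarietyHom_map_map_apply, act4_pr, ← abelianVarietyHom_map_map_apply, hy j, map_smul]
  -- multiplicativity of `(act4 a)^*`, twice
  have h1 : complexBetti.map (act4 A act a).hom.hom.hom 4 (gen A y) =
      cupProduct (show 2 + 2 = 4 by rfl)
        (complexBetti.map (act4 A act a).hom.hom.hom 2
          (cupProduct (show 1 + 1 = 2 by rfl) (complexBetti.map (pr A 0).hom.hom.hom 1 (y 0))
            (complexBetti.map (pr A 1).hom.hom.hom 1 (y 1))))
        (complexBetti.map (act4 A act a).hom.hom.hom 2
          (cupProduct (show 1 + 1 = 2 by rfl) (complexBetti.map (pr A 2).hom.hom.hom 1 (y 2))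
            (complexBetti.map (pr A 3).hom.hom.hom 1 (y 3)))) :=
    cupProduct_map _ _ _ _
  have h2 : ∀ i j : Fin 4, complexBetti.map (act4 A act a).hom.hom.hom 2
      (cupProduct (show 1 + 1 = 2 by rfl) (complexBetti.map (pr A i).hom.hom.hom 1 (y i))
        (complexBetti.map (pr A j).hom.hom.hom 1 (y j))) =
      cupProduct (show 1 + 1 = 2 by rfl)
        (complexBetti.map (act4 A act a).hom.hom.hom 1 (complexBetti.map (pr A i).hom.hom.hom 1 (y i)))
        (complexBetti.map (act4 A act a).hom.hom.hom 1 (complexBetti.map (pr A j).hom.hom.hom 1 (y j))) :=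
    fun i j => cupProduct_map _ _ _ _
  rw [h1, h2, h2, hfac, hfac, hfac, hfac, cupProduct_smul_smul, cupProduct_smul_smul, cupProduct_smul_smul]
  unfold gen
  congr 1
  ring

/-- **A same-character cup monomial, pulled back to `⨁ A`, is a `K`-Weil-line class**: if every `y_j` is a
`σ(a)`-eigenvector of `(act_j a)^*` for all `a ∈ 𝓞_K`, then `ofBiprod^*(pr₀^*y₀ ∪ ⋯ ∪ pr₃^*y₃)` lies in the
simultaneous `σ(a)⁴`-eigenspace of the diagonal action, hence in `weilLineClasses A act 4` (Milne 2020: «`a ∈ E`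
acts on `H^{2p}(A_Δ)_{Δ×{t}}` as multiplication by `∏_{s∈Δ}(t∘s)(a)`»). [cite: Milne2020HodgeClassesAV, §2.1–2.2 and Theorem 1 (proof)] -/
theorem map_ofBiprod_gen_mem_weilLineClasses (act : ∀ j, 𝓞 K →+* End (A j)) (σ : K →+* ℂ)
    (y : ∀ j, complexBetti (A j).X 1)
    (hy : ∀ j (a : 𝓞 K), complexBetti.map (act j a).hom.hom.hom 1 (y j) = σ a • y j) :
    complexBetti.map (ofBiprod A).hom.hom.hom 4 (gen A y) ∈ weilLineClasses A act 4 := by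
  refine iInf_eigenspace_le_weilLineClasses A act 4 σ ?_
  rw [Submodule.mem_iInf]
  intro a
  rw [Module.End.mem_eigenspace_iff]
  change complexBetti.map (diagonalAction A act a).hom.hom.hom 4
      (complexBetti.map (ofBiprod A).hom.hom.hom 4 (gen A y)) = _
  rw [abelianVarietyHom_map_map_apply, diagonalAction_ofBiprod, ← abelianVarietyHom_map_map_apply,
    map_act4_gen A act a y (σ a) (fun j => hy j a), map_smul]

end FourCorner

/-! ## §2 The corner realisations of the model universe, read over `F` -/

variable (hHD : exists_isReal_hodgeModel) (hI : hodgePQ_independent_of_hodgeModel)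
variable (hU : BallQuotientUniformisedDatum) (h₃ : CMAbelianVarietyRealised)
variable (K : CMField) (Φ : Fin 4 → CMType K)

/-- The corner realisations `A_{(F, Φ_j)}`: the chosen abelian varieties of the codes `Model.cmCode F (Φ j)`. [folklore] -/
abbrev cornerAV (j : Fin 4) : AbelianVariety ℂ := (cmRealisation h₃ (Model.cmCode K (Φ j))).AV

/-- Their `𝓞_F`-actions READ OVER `F` (`ι ∘ 𝓞(cmCodeEquiv F (Φ j))`, the spelling of
`Domination.isCMTypeRealisation_cmCode`). [folklore] -/
abbrev cornerAct (j : Fin 4) : 𝓞 K →+* End (cornerAV h₃ K Φ j) :=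
  (cmRealisation h₃ (Model.cmCode K (Φ j))).ι.comp
    (RingOfIntegers.mapRingEquiv (Model.cmCodeEquiv K (Φ j))).toRingHom

/-- Their `H¹`-actions read over `F` (`θ ∘ cmCodeEquiv F (Φ j)`). [folklore] -/
abbrev cornerTheta (j : Fin 4) : (K : Type) →+* Module.End ℂ (complexBetti (cornerAV h₃ K Φ j).X 1) :=
  (cmRealisation h₃ (Model.cmCode K (Φ j))).θ.comp (Model.cmCodeEquiv K (Φ j)).toRingHom

/-- The corner realisations read over `F` realise `(F; Φ_j)` (`Domination.isCMTypeRealisation_cmCode`). [folklore] -/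
theorem cornerAV_isCMTypeRealisation (j : Fin 4) :
    IsCMTypeRealisation (Φ j) (cornerAV h₃ K Φ j) (cornerAct h₃ K Φ j) (cornerTheta h₃ K Φ j) :=
  Domination.isCMTypeRealisation_cmCode K h₃ (Φ j)

/-- The underlying scheme of the four-fold product of the corner realisations IS the interpretation of the model's
`U.prod4 F Φ` (`rfl`). [folklore] -/
theorem prodAV_X : (FourCorner.prodAV (cornerAV h₃ K Φ)).X =
    PicardCM.Var.scheme hU h₃ ((universeOf hHD hI hU h₃).prod4 K Φ) := rfl

/-- The underlying `ℂ`-morphisms of the four projections ARE the model's `U.pr4` (`rfl` case by case). [folklore] -/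
theorem pr_hom (j : Fin 4) :
    (FourCorner.pr (cornerAV h₃ K Φ) j).hom.hom.hom = (universeOf hHD hI hU h₃).pr4 K Φ j := by
  fin_cases j <;> rfl

/-- `(act_j a)^* = θ_j(a)` on `H¹(A_j(ℂ); ℂ)` (the realisation clause `map_ι`, read over `F`). [folklore] -/
theorem map_cornerAct (j : Fin 4) (a : 𝓞 K) (x : complexBetti (cornerAV h₃ K Φ j).X 1) :
    complexBetti.map (cornerAct h₃ K Φ j a).hom.hom.hom 1 x = cornerTheta h₃ K Φ j (a : K) x := by
  have h := (cornerAV_isCMTypeRealisation h₃ K Φ j).2.2.1 a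
  exact congrArg (fun φ : Module.End ℂ (complexBetti (cornerAV h₃ K Φ j).X 1) => φ x) h

end Summit.HodgeConjecture.CorCM.Model

end
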